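import Summits.QuantumAdvantage.QuantumAdvantage.Theses.CubicForrelation
import Summits.QuantumAdvantage.QuantumAdvantage.Theorems.ExactPairsMaioranaMcFarland.Negative.DillonCertificate
import Literature.Computability.QuantumComplexity.ForrelationSignTransport

/-!
# Crux `CubicForrelation.ExactPairsMaioranaMcFarland` (stmt-QuantumAdvantage-2205) — toward stub `stub_defect_vanishing`, I: defect form and isotropic half-spaces

Line `two-adic-local-nongeneric`, stub `stub_defect_vanishing` (the β-half / DEFECT FORM): for an exact cubic pair
(`f`, `g` cubic on `m + m` bits, `g` bent with dual `f`: `W_g = 2^m (-1)^f`) that has an `m`-dimensional SINGULAR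
subspace `V` of the cubic form of `g` (all second derivatives `D_a D_b g`, `a b ∈ V`, CONSTANT in `x`), some
`m`-dimensional `V′` should carry VANISHING second derivatives (Dillon's criterion).  That statement is open
mathematics (implied by the crux; no proof known for `m ≥ 5`) and is NOT proved here; this is one of four `dv_`
helper files (`…DefectVanishing`, `…DefectVanishingDillonDual`, `…DefectVanishingCarlet`,
`…DefectVanishingSmallCases`) landing the provable structure around it, in the crux's definition-free vocabulary
(second derivatives as 4-fold xors `g x ⊕ g (x ⊕ a) ⊕ g (x ⊕ b) ⊕ g (x ⊕ a ⊕ b)`, subspaces as xor-closed finsets of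
size `2^k`).

This file:
* the calculus of second derivatives (`dv_d2_comm`, `dv_d2_self`, `dv_d2_zero_left/right`, `dv_d2_add_left`,
  `dv_d2_shift_left`) and the DEFECT FORM of a singular subspace: `c(a,b) := D_a D_b g` is symmetric, alternating
  and bi-additive on `V` (`dv_defect_add_left`); mechanism (i): if it vanishes, `V′ = V` (`dv_of_defect_zero`);
  the cases `m ≤ 1` (`dv_stub_of_le_one`);
* ISOTROPIC HALF-SPACES (mechanism (ii)): every alternating bilinear form on a finite-dimensional vector space has,
  inside any subspace `W` with `2k ≤ dim W`, a `k`-dimensional totally isotropic subspace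
  (`dv_exists_isotropic_submodule`, induction on `k`; no non-degeneracy needed — E. Artin, *Geometric Algebra*
  (1957), Ch. III), transported to xor-closed finsets along `Negative.ind` (`dv_exists_isotropic_finset`); whence
  the QUADRATIC CASE of the stub for every `m`: if ALL second derivatives of `g` are constant, an `m`-dimensional
  Dillon subspace exists (`dv_stub_of_all_constant`; no bentness needed).

What is NOT here: the stub for `m ≥ 3` (open); Dillon duality, Carlet moves and the case `m = 2` (sibling files);
any use of the degree or duality hypotheses.  Everything is proved from the tree and Mathlib; no named facts.
-/

set_option linter.dupNamespace false -- D-0017: single-problem summit ⇒ `QuantumAdvantage.QuantumAdvantage` by design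

namespace Summit.QuantumAdvantage.QuantumAdvantage.Theorems.CubicForrelation.ExactPairsMaioranaMcFarland

open Finset
open Literature.Computability.QuantumComplexity
open Literature.Computability.QuantumComplexity.BuzetChailloux (bxor)
open Literature.Computability.QuantumComplexity.BuzetChailloux (zeroVec bxor_comm bxor_self bxor_zeroVec
  zeroVec_bxor bxor_bxor_cancel_left bxor_eq_zeroVec_iff twist_bxor_right twist_zeroVec_right sum_twist_left signOf_sq)
open Literature.Computability.QuantumComplexity.Simon (twist_eq_one_or twist_sq sum_twist)
open Literature.Computability.QuantumComplexity.DerivativeWalsh (twist_bxor_left sum_twist_subspace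
  card_mul_sum_coset exists_twist_sum_ne_zero)
open Summit.QuantumAdvantage.QuantumAdvantage.Theorems.ExactPairsMaioranaMcFarland.Negative
  (ind ind_injective ind_bx ite_xor)

/-! ### Bit-vector plumbing -/

/-- `(x ⊕ a) ⊕ a = x`. -/
theorem dv_bxor_cancel_right {n : ℕ} (x a : Fin n → Bool) : bxor (bxor x a) a = x := by
  funext i
  show ((x i ^^ a i) ^^ a i) = x i
  cases x i <;> cases a i <;> rfl

/-- `(x ⊕ a) ⊕ b = x ⊕ (a ⊕ b)`. -/
theorem dv_bxor_assoc {n : ℕ} (x a b : Fin n → Bool) : bxor (bxor x a) b = bxor x (bxor a b) := by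
  funext i
  show ((x i ^^ a i) ^^ b i) = (x i ^^ (a i ^^ b i))
  cases x i <;> cases a i <;> cases b i <;> rfl

/-- `(x ⊕ a) ⊕ b = (x ⊕ b) ⊕ a`. -/
theorem dv_bxor_right_comm {n : ℕ} (x a b : Fin n → Bool) : bxor (bxor x a) b = bxor (bxor x b) a := by
  rw [dv_bxor_assoc, dv_bxor_assoc, bxor_comm a b]

/-! ### The calculus of second derivatives `D_a D_b g (x) = g x ⊕ g (x ⊕ a) ⊕ g (x ⊕ b) ⊕ g (x ⊕ a ⊕ b)` -/

/-- `D_a D_b g = D_b D_a g`. -/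
theorem dv_d2_comm {n : ℕ} (g : (Fin n → Bool) → Bool) (a b x : Fin n → Bool) :
    (g x ^^ g (bxor x a) ^^ g (bxor x b) ^^ g (bxor (bxor x a) b)) =
      (g x ^^ g (bxor x b) ^^ g (bxor x a) ^^ g (bxor (bxor x b) a)) := by
  rw [dv_bxor_right_comm x b a]
  have key : ∀ p q r s : Bool, (p ^^ q ^^ r ^^ s) = (p ^^ r ^^ q ^^ s) := by decide
  exact key _ _ _ _

/-- `D_a D_a g ≡ 0`. -/
theorem dv_d2_self {n : ℕ} (g : (Fin n → Bool) → Bool) (a x : Fin n → Bool) :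
    (g x ^^ g (bxor x a) ^^ g (bxor x a) ^^ g (bxor (bxor x a) a)) = false := by
  rw [dv_bxor_cancel_right]
  have key : ∀ p q : Bool, (p ^^ q ^^ q ^^ p) = false := by decide
  exact key _ _

/-- `D_0 D_b g ≡ 0`. -/
theorem dv_d2_zero_left {n : ℕ} (g : (Fin n → Bool) → Bool) (b x : Fin n → Bool) :
    (g x ^^ g (bxor x zeroVec) ^^ g (bxor x b) ^^ g (bxor (bxor x zeroVec) b)) = false := by
  rw [bxor_zeroVec]
  have key : ∀ p q : Bool, (p ^^ p ^^ q ^^ q) = false := by decide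
  exact key _ _

/-- `D_a D_0 g ≡ 0`. -/
theorem dv_d2_zero_right {n : ℕ} (g : (Fin n → Bool) → Bool) (a x : Fin n → Bool) :
    (g x ^^ g (bxor x a) ^^ g (bxor x zeroVec) ^^ g (bxor (bxor x a) zeroVec)) = false := by
  rw [bxor_zeroVec, bxor_zeroVec]
  have key : ∀ p q : Bool, (p ^^ q ^^ p ^^ q) = false := by decide
  exact key _ _

/-- Additivity in the direction: `D_{a ⊕ a'} D_b g (x) = D_a D_b g (x) ⊕ D_{a'} D_b g (x ⊕ a)`. -/
theorem dv_d2_add_left {n : ℕ} (g : (Fin n → Bool) → Bool) (a a' b x : Fin n → Bool) :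
    (g x ^^ g (bxor x (bxor a a')) ^^ g (bxor x b) ^^ g (bxor (bxor x (bxor a a')) b)) =
      ((g x ^^ g (bxor x a) ^^ g (bxor x b) ^^ g (bxor (bxor x a) b)) ^^
        (g (bxor x a) ^^ g (bxor (bxor x a) a') ^^ g (bxor (bxor x a) b) ^^
          g (bxor (bxor (bxor x a) a') b))) := by
  rw [dv_bxor_assoc x a a']
  have key : ∀ p q r s t w : Bool,
      (p ^^ t ^^ r ^^ w) = ((p ^^ q ^^ r ^^ s) ^^ (q ^^ t ^^ s ^^ w)) := by decide
  exact key _ _ _ _ _ _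

/-- Shift invariance along the direction: `D_a D_b g (x ⊕ a) = D_a D_b g (x)`. -/
theorem dv_d2_shift_left {n : ℕ} (g : (Fin n → Bool) → Bool) (a b x : Fin n → Bool) :
    (g (bxor x a) ^^ g (bxor (bxor x a) a) ^^ g (bxor (bxor x a) b) ^^ g (bxor (bxor (bxor x a) a) b)) =
      (g x ^^ g (bxor x a) ^^ g (bxor x b) ^^ g (bxor (bxor x a) b)) := by
  rw [dv_bxor_cancel_right]
  have key : ∀ p q r s : Bool, (q ^^ p ^^ s ^^ r) = (p ^^ q ^^ r ^^ s) := by decide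
  exact key _ _ _ _

/-! ### The defect form of a singular subspace -/

/-- **The defect form is bi-additive.**  If `D_{a'} D_b g` is constant (e.g. `a', b` in a singular subspace of
the cubic form of `g`), then `D_{a ⊕ a'} D_b g = D_a D_b g ⊕ D_{a'} D_b g` pointwise.  Together with
`dv_d2_comm` (symmetry) and `dv_d2_self` (alternation) this says: on a singular `V` the defect
`c(a,b) := D_a D_b g` is an alternating bilinear form. -/
theorem dv_defect_add_left {n : ℕ} (g : (Fin n → Bool) → Bool) (a a' b : Fin n → Bool)
    (h : ∀ x y : Fin n → Bool,
      (g x ^^ g (bxor x a') ^^ g (bxor x b) ^^ g (bxor (bxor x a') b)) =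
        (g y ^^ g (bxor y a') ^^ g (bxor y b) ^^ g (bxor (bxor y a') b)))
    (x : Fin n → Bool) :
    (g x ^^ g (bxor x (bxor a a')) ^^ g (bxor x b) ^^ g (bxor (bxor x (bxor a a')) b)) =
      ((g x ^^ g (bxor x a) ^^ g (bxor x b) ^^ g (bxor (bxor x a) b)) ^^
        (g x ^^ g (bxor x a') ^^ g (bxor x b) ^^ g (bxor (bxor x a') b))) := by
  rw [dv_d2_add_left, h (bxor x a) x]

/-- **Mechanism (i): a singular subspace with vanishing defect is a Dillon subspace.**  If the second derivatives
along `V` are constant and vanish at one point, they vanish identically, so `V` itself witnesses the conclusion of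
the stub. -/
theorem dv_of_defect_zero {n k : ℕ} (g : (Fin n → Bool) → Bool) (V : Finset (Fin n → Bool))
    (hVx : ∀ a ∈ V, ∀ b ∈ V, bxor a b ∈ V) (hVc : V.card = 2 ^ k)
    (hconst : ∀ a ∈ V, ∀ b ∈ V, ∀ x y : Fin n → Bool,
      (g x ^^ g (bxor x a) ^^ g (bxor x b) ^^ g (bxor (bxor x a) b)) =
        (g y ^^ g (bxor y a) ^^ g (bxor y b) ^^ g (bxor (bxor y a) b)))
    (h0 : ∀ a ∈ V, ∀ b ∈ V,
      (g zeroVec ^^ g (bxor zeroVec a) ^^ g (bxor zeroVec b) ^^ g (bxor (bxor zeroVec a) b)) = false) :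
    ∃ V : Finset (Fin n → Bool), (∀ a ∈ V, ∀ b ∈ V, bxor a b ∈ V) ∧ V.card = 2 ^ k ∧
      ∀ a ∈ V, ∀ b ∈ V, ∀ x : Fin n → Bool,
        (g x ^^ g (bxor x a) ^^ g (bxor x b) ^^ g (bxor (bxor x a) b)) = false :=
  ⟨V, hVx, hVc, fun a ha b hb x => (hconst a ha b hb x zeroVec).trans (h0 a ha b hb)⟩

/-! ### The small cases `m ≤ 1` -/

/-- In an xor-closed set with at most two elements all second derivatives vanish (`V ⊆ {0, a}`). -/
theorem dv_d2_eq_false_of_card_le_two {n : ℕ} (g : (Fin n → Bool) → Bool) (V : Finset (Fin n → Bool))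
    (hVx : ∀ a ∈ V, ∀ b ∈ V, bxor a b ∈ V) (hV2 : V.card ≤ 2) :
    ∀ a ∈ V, ∀ b ∈ V, ∀ x : Fin n → Bool,
      (g x ^^ g (bxor x a) ^^ g (bxor x b) ^^ g (bxor (bxor x a) b)) = false := by
  intro a ha b hb x
  have h0 : zeroVec ∈ V := by
    have h := hVx a ha a ha
    rwa [bxor_self] at h
  by_cases hab : a = b
  · subst hab; exact dv_d2_self g a x
  by_cases ha0 : a = zeroVec
  · subst ha0; exact dv_d2_zero_left g b x
  by_cases hb0 : b = zeroVec
  · subst hb0; exact dv_d2_zero_right g a x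
  exfalso
  have hsub : ({zeroVec, a, b} : Finset (Fin n → Bool)) ⊆ V := by
    intro y hy
    simp only [Finset.mem_insert, Finset.mem_singleton] at hy
    rcases hy with rfl | rfl | rfl
    · exact h0
    · exact ha
    · exact hb
  have h3 : ({zeroVec, a, b} : Finset (Fin n → Bool)).card = 3 := by
    rw [Finset.card_insert_of_notMem, Finset.card_pair hab]
    simp only [Finset.mem_insert, Finset.mem_singleton, not_or]
    exact ⟨fun h => ha0 h.symm, fun h => hb0 h.symm⟩
  have := Finset.card_le_card hsub
  omega

/-- **The stub for `m ≤ 1`** (only the existence of some xor-closed `V` of size `2^m` is used). -/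
theorem dv_stub_of_le_one (m : ℕ) (hm : m ≤ 1) (g : (Fin (m + m) → Bool) → Bool)
    (hV : ∃ V : Finset (Fin (m + m) → Bool), (∀ a ∈ V, ∀ b ∈ V, bxor a b ∈ V) ∧ V.card = 2 ^ m) :
    ∃ V : Finset (Fin (m + m) → Bool), (∀ a ∈ V, ∀ b ∈ V, bxor a b ∈ V) ∧ V.card = 2 ^ m ∧
      ∀ a ∈ V, ∀ b ∈ V, ∀ x : Fin (m + m) → Bool,
        (g x ^^ g (bxor x a) ^^ g (bxor x b) ^^ g (bxor (bxor x a) b)) = false := by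
  obtain ⟨V, hVx, hVc⟩ := hV
  refine ⟨V, hVx, hVc, dv_d2_eq_false_of_card_le_two g V hVx ?_⟩
  rw [hVc]
  calc 2 ^ m ≤ 2 ^ 1 := Nat.pow_le_pow_right (by norm_num) hm
    _ = 2 := by norm_num


/-! ### Isotropic half-spaces of alternating forms (mechanism (ii)) -/

section Isotropic

variable {K E : Type*} [Field K] [AddCommGroup E] [Module K E] [FiniteDimensional K E]

/-- Cutting a subspace by a hyperplane `ker ψ` loses at most one dimension. -/
theorem dv_finrank_le_finrank_inf_ker_add_one (W : Submodule K E) (ψ : E →ₗ[K] K) :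
    Module.finrank K W ≤ Module.finrank K ↥(W ⊓ LinearMap.ker ψ) + 1 := by
  have h1 := Submodule.finrank_sup_add_finrank_inf_eq W (LinearMap.ker ψ)
  have h2 : Module.finrank K ↥(W ⊔ LinearMap.ker ψ) ≤ Module.finrank K E := Submodule.finrank_le _
  have h3 := ψ.finrank_range_add_finrank_ker
  have h4 : Module.finrank K ↥(LinearMap.range ψ) ≤ 1 := by
    have := Submodule.finrank_le (LinearMap.range ψ)
    rwa [Module.finrank_self] at this
  omega

omit [FiniteDimensional K E] in
/-- An alternating form is skew: `B x y = -B y x`. -/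
theorem dv_alt_skew (B : E →ₗ[K] E →ₗ[K] K) (halt : ∀ x, B x x = 0) (x y : E) : B x y = -B y x := by
  have h := halt (x + y)
  simp only [map_add, LinearMap.add_apply, halt, zero_add, add_zero] at h
  linear_combination h

/-- **Isotropic subspaces of alternating forms.**  For an alternating bilinear form `B` on a finite-dimensional
vector space and a subspace `W` with `2k ≤ dim W`, there is a `k`-dimensional subspace `L ≤ W` on which `B`
vanishes identically (induction on `k`: pick `a ≠ 0` in `W`, cut `W` by `ker B(a, ·)` and by a hyperplane missing
`a`, apply the induction hypothesis inside, and add the line through `a`).  In particular (`W = ⊤`, `dim = 2k`)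
every alternating form on `𝔽^{2k}` has a `k`-dimensional totally isotropic subspace, degenerate or not. -/
theorem dv_exists_isotropic_submodule (B : E →ₗ[K] E →ₗ[K] K) (halt : ∀ x, B x x = 0) :
    ∀ (k : ℕ) (W : Submodule K E), 2 * k ≤ Module.finrank K W →
      ∃ L : Submodule K E, L ≤ W ∧ Module.finrank K L = k ∧ ∀ x ∈ L, ∀ y ∈ L, B x y = 0 := by
  intro k
  induction k with
  | zero =>
    intro W _
    refine ⟨⊥, bot_le, finrank_bot K E, ?_⟩
    intro x hx y _
    rw [(Submodule.mem_bot K).1 hx, map_zero, LinearMap.zero_apply]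
  | succ k ih =>
    intro W hW
    have hWne : W ≠ ⊥ := by
      intro h
      rw [h, finrank_bot] at hW
      omega
    obtain ⟨a, haW, ha0⟩ := Submodule.exists_mem_ne_zero_of_ne_bot hWne
    obtain ⟨φ, hφ⟩ := Module.Projective.exists_dual_ne_zero K ha0
    have hW1le : W ⊓ LinearMap.ker (B a) ⊓ LinearMap.ker φ ≤ W := inf_le_left.trans inf_le_left
    have hdim : 2 * k ≤ Module.finrank K ↥(W ⊓ LinearMap.ker (B a) ⊓ LinearMap.ker φ) := by
      have h1 := dv_finrank_le_finrank_inf_ker_add_one W (B a)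
      have h2 := dv_finrank_le_finrank_inf_ker_add_one (W ⊓ LinearMap.ker (B a)) φ
      omega
    have haW1 : a ∉ W ⊓ LinearMap.ker (B a) ⊓ LinearMap.ker φ := fun h =>
      hφ (LinearMap.mem_ker.1 (Submodule.mem_inf.1 h).2)
    have hker : ∀ z ∈ W ⊓ LinearMap.ker (B a) ⊓ LinearMap.ker φ, B a z = 0 := fun z hz =>
      LinearMap.mem_ker.1 (Submodule.mem_inf.1 (Submodule.mem_inf.1 hz).1).2
    obtain ⟨L', hL'W1, hL'k, hL'iso⟩ := ih _ hdim
    refine ⟨Submodule.span K {a} ⊔ L',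
      sup_le ((Submodule.span_singleton_le_iff_mem a W).2 haW) (hL'W1.trans hW1le), ?_, ?_⟩
    · -- dimension count: the line through `a` meets `L'` trivially
      have hinf : Submodule.span K {a} ⊓ L' = ⊥ := by
        rw [eq_bot_iff]
        intro x hx
        obtain ⟨hx1, hx2⟩ := Submodule.mem_inf.1 hx
        obtain ⟨c, rfl⟩ := Submodule.mem_span_singleton.1 hx1
        by_cases hc : c = 0
        · rw [hc, zero_smul]; exact Submodule.zero_mem _
        · exfalso
          apply haW1 (hL'W1 _)
          have := L'.smul_mem c⁻¹ hx2
          rwa [smul_smul, inv_mul_cancel₀ hc, one_smul] at this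
      have h1 := Submodule.finrank_sup_add_finrank_inf_eq (Submodule.span K {a}) L'
      rw [hinf, finrank_bot, add_zero, finrank_span_singleton ha0, hL'k] at h1
      omega
    · -- isotropy
      intro x hx y hy
      obtain ⟨x1, hx1, x2, hx2, rfl⟩ := Submodule.mem_sup.1 hx
      obtain ⟨y1, hy1, y2, hy2, rfl⟩ := Submodule.mem_sup.1 hy
      obtain ⟨c, rfl⟩ := Submodule.mem_span_singleton.1 hx1
      obtain ⟨d, rfl⟩ := Submodule.mem_span_singleton.1 hy1
      have e1 : B a y2 = 0 := hker y2 (hL'W1 hy2)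
      have e2 : B x2 a = 0 := by rw [dv_alt_skew B halt x2 a, hker x2 (hL'W1 hx2), neg_zero]
      simp only [map_add, map_smul, LinearMap.add_apply, LinearMap.smul_apply, smul_eq_mul, halt a, e1, e2,
        hL'iso x2 hx2 y2 hy2, mul_zero, add_zero]

end Isotropic

/-- **Isotropic half-spaces, Boolean form.**  A symmetric, alternating, bi-additive `Bool`-valued form `β` on bit
vectors of length `k + k` vanishes identically on some xor-closed set of size `2^k` (transport of
`dv_exists_isotropic_submodule` along the indicator map `ind : (Fin n → Bool) → (Fin n → ZMod 2)`). -/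
theorem dv_exists_isotropic_finset (k : ℕ) (β : (Fin (k + k) → Bool) → (Fin (k + k) → Bool) → Bool)
    (hself : ∀ a, β a a = false) (hsymm : ∀ a b, β a b = β b a)
    (hadd : ∀ a a' b, β (bxor a a') b = (β a b ^^ β a' b)) :
    ∃ L : Finset (Fin (k + k) → Bool), (∀ a ∈ L, ∀ b ∈ L, bxor a b ∈ L) ∧ L.card = 2 ^ k ∧
      ∀ a ∈ L, ∀ b ∈ L, β a b = false := by
  classical
  -- the Bool / `ZMod 2` dictionary
  have hsurj : Function.Surjective (ind (n := k + k)) := by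
    intro v
    refine ⟨fun i => decide (v i = 1), funext fun i => ?_⟩
    exact (by decide : ∀ a : ZMod 2, (if decide (a = 1) = true then (1 : ZMod 2) else 0) = a) (v i)
  obtain ⟨ι, hι⟩ : ∃ ι : (Fin (k + k) → Bool) ≃ (Fin (k + k) → ZMod 2), ∀ x, ι x = ind x :=
    ⟨Equiv.ofBijective ind ⟨ind_injective, hsurj⟩, fun _ => rfl⟩
  have hι' : ∀ v, ind (ι.symm v) = v := fun v => by rw [← hι, Equiv.apply_symm_apply]
  have hιbx : ∀ a b, ι (bxor a b) = ι a + ι b := fun a b => by rw [hι, hι, hι]; exact ind_bx a b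
  have hbx : ∀ v w, ι.symm (v + w) = bxor (ι.symm v) (ι.symm w) := fun v w => by
    apply ι.injective
    rw [Equiv.apply_symm_apply, hιbx, Equiv.apply_symm_apply, Equiv.apply_symm_apply]
  have hzero : ∀ b, β zeroVec b = false := fun b => by
    have h := hadd b b b
    rw [bxor_self, hself] at h
    exact h
  have hz : ι.symm 0 = zeroVec := by
    apply ι.injective
    rw [Equiv.apply_symm_apply, hι]
    funext i
    simp [ind, zeroVec]
  -- the bilinear form
  obtain ⟨b0, hb0⟩ : ∃ b0 : (Fin (k + k) → ZMod 2) → (Fin (k + k) → ZMod 2) → ZMod 2,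
      ∀ v w, b0 v w = if β (ι.symm v) (ι.symm w) then 1 else 0 := ⟨_, fun _ _ => rfl⟩
  have H1 : ∀ v v' w, b0 (v + v') w = b0 v w + b0 v' w := fun v v' w => by
    rw [hb0, hb0, hb0, hbx, hadd, ite_xor]
  have H2 : ∀ (c : ZMod 2) v w, b0 (c • v) w = c • b0 v w := fun c v w => by
    rcases (by decide : ∀ c : ZMod 2, c = 0 ∨ c = 1) c with rfl | rfl
    · rw [zero_smul, zero_smul, hb0, hz, hzero]
      rfl
    · rw [one_smul, one_smul]
  have Hs : ∀ v w, b0 v w = b0 w v := fun v w => by rw [hb0, hb0, hsymm]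
  let B : (Fin (k + k) → ZMod 2) →ₗ[ZMod 2] (Fin (k + k) → ZMod 2) →ₗ[ZMod 2] ZMod 2 :=
    LinearMap.mk₂ (ZMod 2) b0 H1 H2 (fun v w w' => by rw [Hs v (w + w'), H1, Hs w v, Hs w' v])
      (fun c v w => by rw [Hs v (c • w), H2, Hs w v])
  have hB : ∀ v w, B v w = b0 v w := fun v w => rfl
  have halt : ∀ v, B v v = 0 := fun v => by rw [hB, hb0, hself]; rfl
  have hfin : Module.finrank (ZMod 2) ↥(⊤ : Submodule (ZMod 2) (Fin (k + k) → ZMod 2)) = k + k := by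
    rw [finrank_top, Module.finrank_fintype_fun_eq_card, Fintype.card_fin]
  obtain ⟨L, -, hLk, hLiso⟩ := dv_exists_isotropic_submodule B halt k ⊤ (by rw [hfin]; omega)
  refine ⟨Finset.univ.filter (fun x => ι x ∈ L), ?_, ?_, ?_⟩
  · intro a ha b hb
    simp only [Finset.mem_filter, Finset.mem_univ, true_and] at ha hb ⊢
    rw [hιbx]
    exact L.add_mem ha hb
  · rw [← Fintype.card_subtype, Fintype.card_congr (Equiv.subtypeEquiv ι (fun _ => Iff.rfl) :
        {x // ι x ∈ L} ≃ {v // v ∈ L}), Fintype.card_eq_nat_card]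
    have h := Module.natCard_eq_pow_finrank (K := ZMod 2) (V := L)
    rw [Nat.card_zmod, hLk] at h
    exact h
  · intro a ha b hb
    simp only [Finset.mem_filter, Finset.mem_univ, true_and] at ha hb
    have h := hLiso (ι a) ha (ι b) hb
    rw [hB, hb0, Equiv.symm_apply_apply, Equiv.symm_apply_apply] at h
    cases hab : β a b
    · rfl
    · rw [hab, if_pos rfl] at h
      exact absurd h one_ne_zero

/-- **The quadratic case of the stub, for every `m` (mechanism (ii)).**  If ALL second derivatives of `g` on
`m + m` bits are constant (e.g. `g` quadratic; no bentness or degree hypothesis is used), then some xor-closed `V`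
with `|V| = 2^m` has `D_a D_b g ≡ 0` for all `a b ∈ V`: the constants `c(a,b) = D_a D_b g` form an alternating
bilinear form on `𝔽₂^{2m}` (`dv_defect_add_left`), which has an `m`-dimensional totally isotropic subspace
(`dv_exists_isotropic_finset`). -/
theorem dv_stub_of_all_constant (m : ℕ) (g : (Fin (m + m) → Bool) → Bool)
    (h : ∀ a b x y : Fin (m + m) → Bool,
      (g x ^^ g (bxor x a) ^^ g (bxor x b) ^^ g (bxor (bxor x a) b)) =
        (g y ^^ g (bxor y a) ^^ g (bxor y b) ^^ g (bxor (bxor y a) b))) :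
    ∃ V : Finset (Fin (m + m) → Bool), (∀ a ∈ V, ∀ b ∈ V, bxor a b ∈ V) ∧ V.card = 2 ^ m ∧
      ∀ a ∈ V, ∀ b ∈ V, ∀ x : Fin (m + m) → Bool,
        (g x ^^ g (bxor x a) ^^ g (bxor x b) ^^ g (bxor (bxor x a) b)) = false := by
  obtain ⟨L, hLx, hLc, hL⟩ := dv_exists_isotropic_finset m
    (fun a b => (g zeroVec ^^ g (bxor zeroVec a) ^^ g (bxor zeroVec b) ^^ g (bxor (bxor zeroVec a) b)))
    (fun a => dv_d2_self g a zeroVec) (fun a b => dv_d2_comm g a b zeroVec)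
    (fun a a' b => dv_defect_add_left g a a' b (h a' b) zeroVec)
  exact ⟨L, hLx, hLc, fun a ha b hb x => (h a b x zeroVec).trans (hL a ha b hb)⟩


/-- **Registered sub-goal `stub_defect_vanishing_quadratic_case`** of the stub (= `dv_stub_of_all_constant`): the
quadratic case for every `m` — if all second derivatives of `g` are constant, an `m`-dimensional Dillon subspace
exists. -/
theorem stub_defect_vanishing_quadratic_case :
    ∀ (m : ℕ) (g : (Fin (m + m) → Bool) → Bool),
      (∀ a b x y : Fin (m + m) → Bool,
        (g x ^^ g (bxor x a) ^^ g (bxor x b) ^^ g (bxor (bxor x a) b)) =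
          (g y ^^ g (bxor y a) ^^ g (bxor y b) ^^ g (bxor (bxor y a) b))) →
      ∃ V : Finset (Fin (m + m) → Bool), (∀ a ∈ V, ∀ b ∈ V, bxor a b ∈ V) ∧ V.card = 2 ^ m ∧
        ∀ a ∈ V, ∀ b ∈ V, ∀ x : Fin (m + m) → Bool,
          (g x ^^ g (bxor x a) ^^ g (bxor x b) ^^ g (bxor (bxor x a) b)) = false :=
  dv_stub_of_all_constant

end Summit.QuantumAdvantage.QuantumAdvantage.Theorems.CubicForrelation.ExactPairsMaioranaMcFarland
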